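import Mathlib
import Literature.Barriers.MatrixMultiplication.NilpotentGroupBarrierGradedCoords

/-!
# `SnSubsetDichotomy.NoThresholdSubsetTriple`, line `two-modular-loewy-slice-rank`: `stub_codim`

Blasiak–Church–Cohn–Grochow–Umans 2017 (arXiv:1712.02302), Prop. 3.2, over SUBSPACES, in the
additive form registered by the skeleton of crux `stmt-MatrixMultiplication-8302`
(`Cruxes/NoThresholdSubsetTriple`, stub `stub_codim`): for a finite group `G`, a field `F` and
`F`-subspaces `A, B, C` of the group algebra `F[G] = MonoidAlgebra F G` with `A · B ⊆ C`
(submodule product),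
`slice-rank D_G + dim A + dim B ≤ 2|G| + dim C`, `D_G(x,y,z) = [xyz = 1] = mulGroupTensor F G`,
i.e. `slice-rank D_G ≤ codim A + codim B + dim C` without truncated subtraction.

Proof (BCCGU, §2.3 and Prop. 3.2; the one-basis special case is the tree's
`GradedCoords.hasSliceRankLE`, which is the template followed here):
* `exists_basis_adapted_to_submodule`: a subspace `A ≤ V` has a basis of `V` indexed by
  `Fin (dim A) ⊕ Fin m`, `m = codim A`, with first block inside `A` and such that vectors of `A`
  have no coordinates on the second block (a complement `A'`, `Module.finBasis` on `A` and `A'`,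
  glued through `Submodule.prodEquivOfIsCompl`);
* `mulGroupTensor_eq_subst₃`: for ANY three bases `(xᵢ)`, `(yⱼ)`, `(z_k)` of `F[G]`,
  `D_G(x,y,z) = Σ_k z_k(z⁻¹) · Σ_j [y_j](y) · Σ_i [x_i](x) · [z_k](x_i y_j)` (change of basis in
  each leg; `[x_i](v)` = `i`-th coordinate of `v`);
* `hasSliceRankLE_mulGroupTensor_of_bases`: if the coefficient tensor `[z_k](x_i y_j)` is graded
  (`≠ 0 ⟹ dx i + dy j ≤ dz k`) then `D_G` has a slice decomposition of size
  `#{dx < a} + #{dy < b} + #{a + b ≤ dz}` (`HasSliceRankLE.of_graded` transported by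
  `HasSliceRankLE.subst_left/mid/right`);
* `stub_codim`: with the three adapted bases and the indicator degrees `dx = 𝟙[A-block]`,
  `dy = 𝟙[B-block]`, `dz = 1 + 𝟙[C-block]`, `A · B ⊆ C` is exactly the grading, and at
  thresholds `a = b = 1` the three counts are `codim A`, `codim B`, `dim C`.
-/

namespace Summit.MatrixMultiplication.MatrixMultiplication.Theorems

open scoped BigOperators
open Literature.Barriers.MatrixMultiplication Literature.Combinatorics.Additive

-- `Summit.<Summit>.<Problem>` is the tree's mandated summit-side namespace (CONVENTIONS §2); for
-- this single-conjunct summit the two coincide, so each declaration silences `dupNamespace`.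

set_option linter.dupNamespace false in -- deliberate `Summit.<S>.<P>` duplicate
/-- **Adapted basis.** A subspace `A` of a finite-dimensional space `V` admits a basis of `V`
indexed by `Fin (dim A) ⊕ Fin m` with `m + dim A = dim V`, whose first block lies in `A` and such
that every `v ∈ A` has vanishing coordinates on the second block (glue a basis of `A` and a basis
of a complement of `A`). [folklore] -/
theorem exists_basis_adapted_to_submodule {F V : Type*} [Field F] [AddCommGroup V] [Module F V]
    [FiniteDimensional F V] (A : Submodule F V) :
    ∃ (m : ℕ) (b : Module.Basis (Fin (Module.finrank F A) ⊕ Fin m) F V),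
      m + Module.finrank F A = Module.finrank F V ∧ (∀ i, b (Sum.inl i) ∈ A) ∧
        ∀ v ∈ A, ∀ j, b.repr v (Sum.inr j) = 0 := by
  obtain ⟨A', hA'⟩ := A.exists_isCompl
  refine ⟨Module.finrank F A',
    ((Module.finBasis F A).prod (Module.finBasis F A')).map (Submodule.prodEquivOfIsCompl A A' hA'),
    ?_, fun i => ?_, fun v hv j => ?_⟩
  · rw [add_comm]
    exact Submodule.finrank_add_eq_of_isCompl hA'
  · rw [Module.Basis.map_apply, Submodule.coe_prodEquivOfIsCompl',
      Module.Basis.prod_apply_inl_fst, Module.Basis.prod_apply_inl_snd, Submodule.coe_zero,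
      add_zero]
    exact Submodule.coe_mem _
  · rw [Module.Basis.map_repr, LinearEquiv.trans_apply,
      show (Submodule.prodEquivOfIsCompl A A' hA').symm v = (⟨v, hv⟩, 0) from
        Submodule.prodEquivOfIsCompl_symm_apply_left A A' hA' ⟨v, hv⟩,
      Module.Basis.prod_repr_inr, map_zero, Finsupp.zero_apply]

set_option linter.dupNamespace false in -- deliberate `Summit.<S>.<P>` duplicate
/-- Counting through a parametrisation: if `f : κ → ι` takes values in `{i // p i}` and hits every
element of it, then `#{i // p i} ≤ |κ|`. [folklore] -/
theorem card_subtype_le_of_range {ι κ : Type*} [Fintype ι] [Fintype κ] {p : ι → Prop}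
    [DecidablePred p] (f : κ → ι) (hp : ∀ k, p (f k)) (hf : ∀ i, p i → ∃ k, f k = i) :
    Fintype.card {i // p i} ≤ Fintype.card κ := by
  refine Fintype.card_le_of_surjective (fun k => (⟨f k, hp k⟩ : {i // p i})) fun i => ?_
  obtain ⟨k, hk⟩ := hf i.1 i.2
  exact ⟨k, Subtype.ext hk⟩

set_option linter.dupNamespace false in -- deliberate `Summit.<S>.<P>` duplicate
/-- **`D_G` in three bases** (BCCGU 2017, §2.3, three-leg version of the tree's
`GradedCoords.mulGroupTensor_eq_subst`): for bases `(xᵢ)`, `(yⱼ)`, `(z_k)` of `F[G]`,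
`[xyz = 1] = Σ_k z_k(z⁻¹) · Σ_j [y_j](y) · Σ_i [x_i](x) · [z_k](x_i · y_j)`, where `[x_i](v)` is
the `i`-th coordinate of `v` and `z_k(g)` the coefficient of `g` in `z_k`. [folklore] -/
theorem mulGroupTensor_eq_subst₃ {F : Type*} [Field F] {G : Type*} [Group G] [Fintype G]
    [DecidableEq G] {X Y Z : Type*} [Fintype X] [Fintype Y] [Fintype Z]
    (bX : Module.Basis X F (MonoidAlgebra F G)) (bY : Module.Basis Y F (MonoidAlgebra F G))
    (bZ : Module.Basis Z F (MonoidAlgebra F G)) :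
    mulGroupTensor F G = fun x y z =>
      ∑ k, (bZ k).coeff z⁻¹ * ∑ j, bY.repr (MonoidAlgebra.of F G y) j *
        ∑ i, bX.repr (MonoidAlgebra.of F G x) i * bZ.repr (bX i * bY j) k := by
  funext x y z
  -- contraction in the first leg: `Σ_i [x_i](x) [z_k](x_i v) = [z_k](x v)`
  have h1 : ∀ (v : MonoidAlgebra F G) (k : Z),
      ∑ i, bX.repr (MonoidAlgebra.of F G x) i * bZ.repr (bX i * v) k =
        bZ.repr (MonoidAlgebra.of F G x * v) k := by
    intro v k
    conv_rhs => rw [← bX.sum_repr (MonoidAlgebra.of F G x)]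
    rw [Finset.sum_mul, map_sum, Finsupp.finsetSum_apply]
    refine Finset.sum_congr rfl fun i _ => ?_
    rw [smul_mul_assoc, map_smul, Finsupp.smul_apply, smul_eq_mul]
  -- contraction in the second leg: `Σ_j [y_j](y) [z_k](x y_j) = [z_k](x y)`
  have h2 : ∀ k : Z, ∑ j, bY.repr (MonoidAlgebra.of F G y) j *
      bZ.repr (MonoidAlgebra.of F G x * bY j) k =
        bZ.repr (MonoidAlgebra.of F G x * MonoidAlgebra.of F G y) k := by
    intro k
    conv_rhs => rw [← bY.sum_repr (MonoidAlgebra.of F G y)]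
    rw [Finset.mul_sum, map_sum, Finsupp.finsetSum_apply]
    refine Finset.sum_congr rfl fun j _ => ?_
    rw [mul_smul_comm, map_smul, Finsupp.smul_apply, smul_eq_mul]
  -- contraction in the third leg: `Σ_k z_k(g) [z_k](v) = v(g)`
  have h3 : ∀ v : MonoidAlgebra F G, ∑ k, (bZ k).coeff z⁻¹ * bZ.repr v k = v.coeff z⁻¹ := by
    intro v
    conv_rhs => rw [← bZ.sum_repr v]
    rw [MonoidAlgebra.coeff_sum, Finsupp.finsetSum_apply]
    refine Finset.sum_congr rfl fun k _ => ?_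
    rw [MonoidAlgebra.coeff_smul, Finsupp.smul_apply, smul_eq_mul, mul_comm]
  simp_rw [h1, h2]
  rw [h3, ← (MonoidAlgebra.of F G).map_mul x y, MonoidAlgebra.of_apply, MonoidAlgebra.coeff_single]
  simp_rw [Finsupp.single_apply, mulGroupTensor_apply, eq_inv_iff_mul_eq_one]

set_option linter.dupNamespace false in -- deliberate `Summit.<S>.<P>` duplicate
/-- **Graded three-basis slice-rank bound** (BCCGU 2017, Prop. 3.2 in coordinates; three-leg
version of the tree's `GradedCoords.hasSliceRankLE`): if the coefficient tensor
`[z_k](x_i · y_j)` of `F[G]` in bases `(xᵢ)`, `(yⱼ)`, `(z_k)` vanishes unless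
`dx i + dy j ≤ dz k`, then `D_G` has a slice decomposition with
`#{i : dx i < a} + #{j : dy j < b} + #{k : a + b ≤ dz k}` slices. [folklore] -/
theorem hasSliceRankLE_mulGroupTensor_of_bases {F : Type*} [Field F] {G : Type*} [Group G]
    [Fintype G] [DecidableEq G] {X Y Z : Type*} [Fintype X] [Fintype Y] [Fintype Z]
    [DecidableEq X] [DecidableEq Y] [DecidableEq Z]
    (bX : Module.Basis X F (MonoidAlgebra F G)) (bY : Module.Basis Y F (MonoidAlgebra F G))
    (bZ : Module.Basis Z F (MonoidAlgebra F G)) (dx : X → ℕ) (dy : Y → ℕ) (dz : Z → ℕ)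
    (hgr : ∀ i j k, bZ.repr (bX i * bY j) k ≠ 0 → dx i + dy j ≤ dz k) (a b : ℕ) :
    HasSliceRankLE (mulGroupTensor F G)
      (Fintype.card {i // dx i < a} + Fintype.card {j // dy j < b} +
        Fintype.card {k // a + b ≤ dz k}) := by
  rw [mulGroupTensor_eq_subst₃ bX bY bZ]
  exact (((HasSliceRankLE.of_graded (fun i j k => bZ.repr (bX i * bY j) k) dx dy dz hgr a
    b).subst_left (fun x i => bX.repr (MonoidAlgebra.of F G x) i)).subst_mid
      (fun y j => bY.repr (MonoidAlgebra.of F G y) j)).subst_right (fun z k => (bZ k).coeff z⁻¹)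

set_option linter.dupNamespace false in -- deliberate `Summit.<S>.<P>` duplicate
/-- **Stub `stub_codim` of line `two-modular-loewy-slice-rank` (crux
`SnSubsetDichotomy.NoThresholdSubsetTriple`, stmt-MatrixMultiplication-8302) — BCCGU 2017,
Prop. 3.2: the codimension bound over SUBSPACES.**  For a finite group `G`, a field `F` and
`F`-subspaces `A, B, C` of `F[G]` with `A · B ⊆ C` (submodule product):
`slice-rank_F D_G + dim A + dim B ≤ 2|G| + dim C`, i.e. `slice-rank D_G ≤ codim A + codim B + dim C`
(`dim F[G] = |G|`).  Proof: bases of `F[G]` adapted to `A` (first leg), `B` (second leg), `C`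
(third leg) (`exists_basis_adapted_to_submodule`); in these coordinates the coefficient tensor
`[z_k](x_i · y_j)` is graded for the indicator degrees `dx = 𝟙[A-block]`, `dy = 𝟙[B-block]`,
`dz = 1 + 𝟙[C-block]` because `x_i · y_j ∈ A · B ⊆ C` has no coordinates off the `C`-block;
`hasSliceRankLE_mulGroupTensor_of_bases` at thresholds `a = b = 1` counts `#{dx < 1} = codim A`,
`#{dy < 1} = codim B`, `#{dz ≥ 2} = dim C`. [folklore] -/
theorem stub_codim (F : Type) [Field F] (G : Type) [Group G] [Fintype G] [DecidableEq G]
    (A B C : Submodule F (MonoidAlgebra F G)) (hABC : A * B ≤ C) :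
    sliceRank (mulGroupTensor F G) + Module.finrank F A + Module.finrank F B ≤
      2 * Fintype.card G + Module.finrank F C := by
  obtain ⟨mA, bX, hmA, hXA, -⟩ := exists_basis_adapted_to_submodule A
  obtain ⟨mB, bY, hmB, hYB, -⟩ := exists_basis_adapted_to_submodule B
  obtain ⟨mC, bZ, -, -, hZC⟩ := exists_basis_adapted_to_submodule C
  have hV : Module.finrank F (MonoidAlgebra F G) = Fintype.card G :=
    Module.finrank_eq_card_basis (MonoidAlgebra.basis G F)
  -- indicator degrees
  let dX : Fin (Module.finrank F A) ⊕ Fin mA → ℕ := Sum.elim (fun _ => 1) (fun _ => 0)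
  let dY : Fin (Module.finrank F B) ⊕ Fin mB → ℕ := Sum.elim (fun _ => 1) (fun _ => 0)
  let dZ : Fin (Module.finrank F C) ⊕ Fin mC → ℕ := Sum.elim (fun _ => 2) (fun _ => 1)
  -- the grading `A · B ⊆ C`
  have hgr : ∀ i j k, bZ.repr (bX i * bY j) k ≠ 0 → dX i + dY j ≤ dZ k := by
    rintro (i | i) (j | j) (k | k) hne
    · simp [dX, dY, dZ]
    · exact absurd (hZC _ (hABC (Submodule.mul_mem_mul (hXA i) (hYB j))) k) hne
    all_goals simp [dX, dY, dZ]
  have hSR := (hasSliceRankLE_mulGroupTensor_of_bases bX bY bZ dX dY dZ hgr 1 1).sliceRank_le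
  -- the three counts
  have c1 : Fintype.card {i // dX i < 1} ≤ mA :=
    (card_subtype_le_of_range Sum.inr (fun _ => by simp [dX]) (by
      rintro (a | b) h
      · simp [dX] at h
      · exact ⟨b, rfl⟩)).trans_eq (Fintype.card_fin mA)
  have c2 : Fintype.card {j // dY j < 1} ≤ mB :=
    (card_subtype_le_of_range Sum.inr (fun _ => by simp [dY]) (by
      rintro (a | b) h
      · simp [dY] at h
      · exact ⟨b, rfl⟩)).trans_eq (Fintype.card_fin mB)
  have c3 : Fintype.card {k // 1 + 1 ≤ dZ k} ≤ Module.finrank F C :=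
    (card_subtype_le_of_range Sum.inl (fun _ => by simp [dZ]) (by
      rintro (a | b) h
      · exact ⟨a, rfl⟩
      · simp [dZ] at h)).trans_eq (Fintype.card_fin _)
  omega

end Summit.MatrixMultiplication.MatrixMultiplication.Theorems
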